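import Summits.BirchSwinnertonDyer.BirchSwinnertonDyer.Theses.ResidualThetaTransportAtTwo
import Summits.BirchSwinnertonDyer.BirchSwinnertonDyer.Theorems.ResidualThetaTransportAtTwoKatoZetaDefs
import Summits.BirchSwinnertonDyer.BirchSwinnertonDyer.Theorems.ThetaPartnerAtTwoSignedKatoUpToAtTwoKatoBKCoreKZLit
import Summits.BirchSwinnertonDyer.BirchSwinnertonDyer.Theorems.ThetaPartnerAtTwoSignedKatoUpToAtTwoCyclotomicPadicEmbedding
import Summits.BirchSwinnertonDyer.BirchSwinnertonDyer.Theorems.ResidualThetaTransportAtTwoResidualSignedLambdaLowerCMAtTwoChildACoordinates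
import Literature.NumberTheory.EllipticCurves.Kato2004.ZetaElementNewformTatePairingValuesTwo
import HarnessLib

/-!
# Child A of KZ_g at the one-pair pins (crux RSL_g `ResidualSignedLambdaLowerCMAtTwo`, stmt-BirchSwinnertonDyer-22608, line `onepair`) —
# file A2: the KERNEL PORT «Kato 2004 Thm. 12.5 (1) BY NAME ⟹ a valued class `π.KatoValuedClass …` at the pins», and the registered
# stub `stub_kzgChildA` from the named fact

Route `ResidualThetaTransportAtTwo` (RTT); width seat `bsd-wall-tp2-p2x-w3` g19 (`--supports stmt-BirchSwinnertonDyer-22608`, helper; closes no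
item). THEOREMS ONLY (no definition, no named fact, no instance, no notation, no `sorry`). BSD is not proved by anything here; 22608 / 26074 stay OPEN,
24105 HELD.

CONTEXT. The registered skeleton `Cruxes/ResidualSignedLambdaLowerCMAtTwo/Lines/onepair.lean` (v3g) has every KERNEL stub landed; its PRINT stub
`stub_kzgChildA` (child A `KatoZetaValuedClassCMAtTwo` of the HOLD item 24105: at the pins `π`, for every `2`-adic frame `F`,
`∃ z c′ w q μt, π.KatoValuedClass g ι Ω F.Φ F.τ z c′ w q μt`, vocabulary of `Theorems/ResidualThetaTransportAtTwoKatoZetaDefs.lean`) is «Kato 2004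
Thm. 12.5 (1) for the CM θ-partner `g` at `p = 2` with `𝒪_λ`-coefficients». That printed theorem is now TYPED BY NAME at the one-pair pins:
`Kato2004.exists_zetaElement_newform_tatePairing_values_two` (`Literature/…/Kato2004/ZetaElementNewformTatePairingValuesTwo.lean`, p726418; binders =
the `OnePairPins` fields, the layer pairing pinned by `rhoLayerPairingPk`, a coherent cyclotomic frame `(ζc, e, τ)`; outputs = Kato's class `z`,
`ℚ₂`-linear comparison functionals `ℓ_i` separating `𝒪`, RATIONAL values `Σ_k f_{N,k} ⊗ u_{N,k} ∈ K_g ⊗ ℚ(ζ_{2^N})`, a period ratio `r ≠ 0`, with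
clauses (ND)/(BK)/(VAL)/(TRIV)). THIS FILE is the port recipe P1–P5 of the route pen (bsd-wall STATUS 2026-08-29T14:49:11Z) in kernel:

* (P3) `ChildA.exists_cyclotomicFrame` — from a `KatoFrame`'s Galois lifts `τ` (acting on the tree's tower `PadicCyclotomicTower.zeta 2` by powers) a
  COHERENT tower `e_k : ℚ(ζ_{2^k}) →ₐ[ℚ] ℚ̄₂` with `e_k(ζ_{2^k}) = zeta 2 k` (`KatoValue.exists_ringHom_zeta_eq_padicZeta`, coherence `zeta_succ_pow`);
  `ChildA.smul_frame_eq_map_sigma` — `τ_b • e_k(y) = e_k(σ_b y)` (`KatoValue.map_sigma_eq_smul`); `ChildA.zmodChar_eq_of_eq` (Gauss-sum plumbing).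
* **`katoValuedClass_of_zetaElement`** — THE PORT: given the fact, for every pin bundle `π` and frame `F` a valued class exists, with the WITNESSES
  `z :=` Kato's class; `c′_i := Σ_j 2^s ℓ_i(bO_j) bO′_j ∈ 𝒪` (P2, `ThetaTransport.ChildA.exists_frobeniusCoords`: `t₀(c′_i a) = 2^s ℓ_i(a)` on `𝒪`);
  `w_{N,j} := Σ_k 2^{−(t_N+s)} t₀(φ_{N,k} bO′_j) · e_N(u_{N,k})` where `φ_{N,k} = 2^{t_N} ι(f_{N,k}) ∈ 𝒪` (P2, one exponent per level);
  `q := 2^{−s} ι(r) ≠ 0`; `μt := 1` (P4). Then: `CoordNondeg c′` ⟸ (ND); (BKρ) ⟸ (BK) through the LOG BRIDGE `KatoBK.ptLogΩ_toLoc_symm_eq` and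
  `toLoc_symm_mem_kernel_iff` (P1, TP2's tree lemmas) and the identity `ℓ_i(a ι f_{N,k}) = Σ_j t₀(c′_i a bO_j) · 2^{−(t_N+s)} t₀(φ_{N,k} bO′_j)`
  (dual-basis expansion, the `𝒪`-constants OUTSIDE the Galois sums); (VALρ) ⟸ (VAL) in the realisation `(R, s₁, s₂) = (ℚ̄₂, ι, e_N)` with
  `τ_b • w_{N,j} = Σ_k (…) e_N(σ_b u_{N,k})`, the RECOMBINATION identity `Σ_j bO_j Σ_k 2^{−(t+s)} t₀(φ_k bO′_j) A_k = 2^{−s} Σ_k ι(f_k) A_k`, equal Gauss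
  sums at `e_N(ζ) = zeta 2 N`, and `Σ_k μt_k (ψ(5) − 1)^k = 1`; (TRIVρ) ⟸ (TRIV) at `N = 2, 3` with `a₂(g) = 0` and `M` odd (`2 − a₂ + ε_M(2) = 3`,
  the consumer's `3/2`) (P5).
* **`stub_kzgChildA_of_zetaElement`** — the REGISTERED v3g text of `stub_kzgChildA` VERBATIM under the single hypothesis
  `Kato2004.exists_zetaElement_newform_tatePairing_values_two`: child A is now «fact BY NAME + kernel»; splice for the LEAD's next touch: join the fact
  to `stub_printInputs` and set `stub_kzgChildA := stub_kzgChildA_of_zetaElement ‹fact›`.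

HONEST FRAMING: a CONDITIONAL port (the print content is the named fact, Kato's Thm. 12.5 (1) — XL, no `_holds` expected); nothing about any curve or
form is asserted unconditionally; the idle binders of the registered text (`¬CM`, `r_an = 0`, the Pollack pair, `Sg`, …) are not used.

References: [Kato2004Asterisque] Thm. 12.5 (1) (pp. 221–222), Thm. 12.6, §13.9–13.12, §15.16 (p. 265); [BlochKato1990] §3 (3.10.1), (3.11);
[Kobayashi2003] (8.23), (8.29); [Lang2002] Ch. VI §5 Cor. 5.3 (dual bases); [Washington1997] Ch. 2 Thm. 2.5 (embeddings of `ℚ(ζ_m)`).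
Tree: `…KatoZetaDefs.lean` (the predicates), `…Defs.lean` (`OnePairPins`), `Kato2004/ZetaElementNewformTatePairingValuesTwo.lean` (the fact),
`…ThetaPartnerAtTwoSignedKatoUpToAtTwoKatoBKCoreKZLit.lean` (`ptLogΩ_toLoc_symm_eq`), `…CyclotomicPadicEmbedding.lean` (`KatoValue.*`),
`…ChildACoordinates.lean` (P2 algebra, p727504).
-/

set_option autoImplicit false
-- the Theorems namespace of this sub repeats the summit name by design (D-0017 nested layout)
set_option linter.dupNamespace false
-- `IsCyclotomicExtension {2^k} ℚ (CyclotomicField (2^k) ℚ)` through `NeZero`, as in `KatoZetaDefs` / `CyclotomicPadicEmbedding`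
set_option backward.isDefEq.respectTransparency false

noncomputable section

open scoped Classical NumberField TensorProduct

namespace Summit.BirchSwinnertonDyer.BirchSwinnertonDyer.Theorems.OnePair

open Literature.NumberTheory.EllipticCurves Literature.NumberTheory.EllipticCurves.GreenbergSelmer
open Literature.NumberTheory.GaloisRepresentations NumberField IsDedekindDomain Field
open GreenbergVatsal2000 Kobayashi2003 Rat.HeightOneSpectrum PowerSeries
open Literature.NumberTheory.EllipticCurves.FormalGroupChart
open Literature.NumberTheory.EllipticCurves.ModularForms
open Literature.NumberTheory.EllipticCurves.Kato2004 Literature.NumberTheory.EllipticCurves.Kato2004.EulerSystemValues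
open Summit.BirchSwinnertonDyer.Rank1Residual.Additive Summit.BirchSwinnertonDyer.Rank1Residual.Additive.PadicCyclotomicTower
  Summit.BirchSwinnertonDyer.Rank1Residual.Additive.BallEval
open Summit.BirchSwinnertonDyer.BirchSwinnertonDyer.Theorems.SignedKatoOffTwo
  Summit.BirchSwinnertonDyer.BirchSwinnertonDyer.Theorems.SignedKatoOffTwo.LocalTwo

namespace ChildA

/-! ## §1 The cyclotomic frame of the fact from a `KatoFrame`: `e_k : ℚ(ζ_{2^k}) → ℚ̄₂`, `e_k(ζ) = zeta 2 k` -/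

/-- **A coherent tower of embeddings `e_k : ℚ(ζ_{2^k}) →ₐ[ℚ] ℚ̄₂` with `e_k(ζ_{2^k}) = zeta 2 k`** (the tree's `2`-adic tower
`PadicCyclotomicTower.zeta 2`, coherent by `zeta_succ_pow`), on which Galois lifts `τ_{k,a}` with `τ_{k,a} • zeta 2 k = (zeta 2 k)^a`
act by `a`-th powers — the `(ζc, e, τ)`-frame the named fact `Kato2004.exists_zetaElement_newform_tatePairing_values_two` quantifies over,
built from the route's `KatoFrame`. [cite: Washington1997, Ch. 2 Thm. 2.5] [cite: Kobayashi2003, §8.4] -/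
theorem exists_cyclotomicFrame (τ : ∀ m : ℕ, ZMod (2 ^ m) → Field.absoluteGaloisGroup ℚ_[2])
    (hτ : ∀ (m : ℕ) (a : ZMod (2 ^ m)), IsUnit a → τ m a • zeta 2 m = zeta 2 m ^ a.val) :
    ∃ e : ∀ k : ℕ, CyclotomicField (2 ^ k) ℚ →ₐ[ℚ] PadicAlgCl 2,
      (∀ k, e k (IsCyclotomicExtension.zeta (2 ^ k) ℚ (CyclotomicField (2 ^ k) ℚ)) = zeta 2 k) ∧
      (∀ k, e (k + 1) (IsCyclotomicExtension.zeta (2 ^ (k + 1)) ℚ (CyclotomicField (2 ^ (k + 1)) ℚ)) ^ 2 =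
        e k (IsCyclotomicExtension.zeta (2 ^ k) ℚ (CyclotomicField (2 ^ k) ℚ))) ∧
      (∀ (k : ℕ) (a : ZMod (2 ^ k)), IsUnit a →
        τ k a • e k (IsCyclotomicExtension.zeta (2 ^ k) ℚ (CyclotomicField (2 ^ k) ℚ)) =
          e k (IsCyclotomicExtension.zeta (2 ^ k) ℚ (CyclotomicField (2 ^ k) ℚ)) ^ a.val) := by
  have key : ∀ k : ℕ, ∃ e : CyclotomicField (2 ^ k) ℚ →ₐ[ℚ] PadicAlgCl 2,
      e (IsCyclotomicExtension.zeta (2 ^ k) ℚ (CyclotomicField (2 ^ k) ℚ)) = zeta 2 k := by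
    intro k
    obtain ⟨e, he⟩ := KatoValue.exists_ringHom_zeta_eq_padicZeta 2 k (m := 2 ^ k) rfl
    exact ⟨e.toRatAlgHom, he⟩
  choose e he using key
  refine ⟨e, he, fun k ↦ ?_, fun k a ha ↦ ?_⟩
  · rw [he, he]; exact zeta_succ_pow 2 k
  · rw [he]; exact hτ k a ha

/-- `τ_b • e_k(y) = e_k(σ_b y)` on the frame of `exists_cyclotomicFrame` (`σ_b` Kato's automorphism `ζ ↦ ζ^b` of `ℚ(ζ_{2^k})`).
[cite: Kato2004Asterisque, (5.7.1) (p. 157)] -/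
theorem smul_frame_eq_map_sigma (τ : ∀ m : ℕ, ZMod (2 ^ m) → Field.absoluteGaloisGroup ℚ_[2])
    (hτ : ∀ (m : ℕ) (a : ZMod (2 ^ m)), IsUnit a → τ m a • zeta 2 m = zeta 2 m ^ a.val)
    (e : ∀ k : ℕ, CyclotomicField (2 ^ k) ℚ →ₐ[ℚ] PadicAlgCl 2)
    (he : ∀ k, e k (IsCyclotomicExtension.zeta (2 ^ k) ℚ (CyclotomicField (2 ^ k) ℚ)) = zeta 2 k)
    (k : ℕ) (b : (ZMod (2 ^ k))ˣ) (y : CyclotomicField (2 ^ k) ℚ) :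
    τ k (b : ZMod (2 ^ k)) • e k y = e k (sigma (2 ^ k) b y) := by
  have h := KatoValue.map_sigma_eq_smul (p := 2) (k := k) (m := 2 ^ k) (e k : CyclotomicField (2 ^ k) ℚ →+* PadicAlgCl 2)
    (he k) (τ k (b : ZMod (2 ^ k))) b (hτ k _ b.isUnit) y
  exact h.symm

/-- Two `zmodChar`s at equal roots of unity coincide (proof-irrelevance plumbing for the Gauss sums of (VAL)). [folklore] -/
theorem zmodChar_eq_of_eq {R : Type*} [CommRing R] {N : ℕ} [NeZero N] {ζ ζ' : R} (hζ : ζ ^ N = 1) (hζ' : ζ' ^ N = 1) (h : ζ = ζ') :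
    AddChar.zmodChar N hζ = AddChar.zmodChar N hζ' := by
  subst h; rfl

end ChildA

/-! ## §2 The port: Kato Thm. 12.5 (1) BY NAME ⟹ a valued class at the pins -/

section Port

variable {M : ℕ} [NeZero M] (g : CuspForm (CongruenceSubgroup.Gamma0 M) 2) (ι : coeffField g →+* PadicAlgCl 2) (Ω : ℂ)
  {W : WeierstrassCurve ℚ} [W.IsElliptic] [W.IsGloballyMinimal] {κ : ZpExtension ℚ 2} {γ : absoluteGaloisGroup ℚ}
  {S₀ : Finset (HeightOneSpectrum (𝓞 ℚ))} {n : ℕ} {ρ : FramedGaloisRep ℚ ↥(padicCoeffIntegers (Set.range ι)) 2}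
  {Θ : ∀ v : HeightOneSpectrum (𝓞 ℚ), ((2 : ℕ) : 𝓞 ℚ) ∈ v.asIdeal →
    (Cofree ρ ↥(padicCoeffField (Set.range ι)) ≃+ (Fin n → ↥(W.geomPrimaryTorsion 2)))}
  {hΘ : ∀ v hv (δ : absoluteGaloisGroup (v.adicCompletion ℚ)) m i,
    Θ v hv (resGalOfEmb (closureEmb (K := ℚ) (v.adicCompletion ℚ)) δ • m) i = resGalOfEmb (closureEmb (K := ℚ) (v.adicCompletion ℚ)) δ • Θ v hv m i}
  {I : Kato2004.IwasawaH1DataCoeff (FramedGaloisRep.toGaloisRep ρ) 2 κ γ}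
  {Sg : AddSubgroup (subgroupH1 κ.kerSubgroup (Cofree ρ ↥(padicCoeffField (Set.range ι))))}
  [Module ↥(padicCoeffIntegers (Set.range ι)) ↥Sg]
  (π : OnePairPins (Set.range ι) W κ γ S₀ n ρ Θ hΘ I Sg) (F : π.KatoFrame)

set_option maxHeartbeats 1600000 in
/-- **THE PORT: Kato 2004 Thm. 12.5 (1) BY NAME ⟹ a valued class at the one-pair pins.** For a newform `g ∈ S₂(Γ₀(M))` (`M` odd,
`a₂(g) = 0`), `ι : K_g → ℚ̄₂`, a Shimura period `Ω`, an integral model `ρ` of `g` along `ι`, the cyclotomic `κ, γ`, a datum `I`, every pin bundle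
`π : OnePairPins (Set.range ι) W κ γ S₀ n ρ Θ hΘ I Sg` and every `2`-adic frame `F : π.KatoFrame`: the named fact
`Kato2004.exists_zetaElement_newform_tatePairing_values_two` yields `z c′ w q μt` with `π.KatoValuedClass g ι Ω F.Φ F.τ z c′ w q μt`
(`q ≠ 0 ∧ μt ≠ 0 ∧ CoordNondeg ∧ (BKρ) ∧ (VALρ) ∧ (TRIVρ)`). Witnesses: `z` = Kato's class; `c′_i = Σ_j 2^s ℓ_i(bO_j) bO′_j` (Frobenius coordinates of
the fact's comparison functionals); `w_{N,j} = Σ_k 2^{−(t_N+s)} t₀(2^{t_N} ι f_{N,k} · bO′_j) e_N(u_{N,k})` (the `bO`-coordinates of the rational values,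
`e_N(ζ) = zeta 2 N`); `q = 2^{−s} ι(r)`; `μt = 1`. See the module docstring for the clause-by-clause derivation (P1–P5).
[cite: Kato2004Asterisque, Thm. 12.5 (1) (pp. 221–222), §15.16 (p. 265)] [cite: BlochKato1990, §3 (3.10.1), (3.11) (pp. 359–361)]
[cite: Kobayashi2003, (8.23) (p. 18), (8.29) (p. 24)] [cite: Lang2002, Ch. VI §5 Cor. 5.3] -/
theorem katoValuedClass_of_zetaElement (hfact : Kato2004.exists_zetaElement_newform_tatePairing_values_two)
    (hg : IsNewform0 g) (hΩ : IsPlusPeriod g Ω) (hM : Odd M) (ha2 : cuspCoeff g 2 = 0)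
    (hρ : ∀ v : HeightOneSpectrum (𝓞 ℚ), ¬ natGenerator v ∣ 2 * M →
      ρ.IsUnramifiedAt v ∧
        ∃ P : Polynomial ↥(padicCoeffIntegers (Set.range ι)),
          P.map (padicCoeffIntegers (Set.range ι)).subtype =
              Polynomial.X ^ 2 - Polynomial.C (embCoeff g ι (natGenerator v)) * Polynomial.X +
                Polynomial.C ((natGenerator v : ℕ) : PadicAlgCl 2) ∧
            ρ.HasFrobCharpolyAt v P)
    (hκ : κ.IsCyclotomic) (hγ : κ.IsTopGenerator γ) :
    ∃ (z : I.H) (c' : Fin n → ↥(padicCoeffIntegers (Set.range ι))) (w : ℕ → Fin π.nb → PadicAlgCl 2) (q : PadicAlgCl 2)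
      (μt : IwasawaAlgebraO (Set.range ι)), π.KatoValuedClass g ι Ω F.Φ F.τ z c' w q μt := by
  -- (P3) the cyclotomic frame of the fact from `F`
  obtain ⟨e, he, hcoh, heτ⟩ := ChildA.exists_cyclotomicFrame F.τ F.hτ
  -- instantiate Kato Thm. 12.5 (1) at the pins
  obtain ⟨z, ℓ, L, f, u, r, hr, hND, hBK, hVAL, hTRIV⟩ :=
    hfact M g ι Ω ρ κ γ hg hΩ hρ hκ hγ I W n π.v π.hv (Θ π.v π.hv) (hΘ π.v π.hv) π.t₀ π.ht₀ π.nb π.bO π.bO' π.hbO π.ζ π.hζ π.ePk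
      π.hμPk π.hadd₁Pk π.hadd₂Pk π.hgalPk π.hePk π.pair π.hpair F.Φ F.φ F.hΦφ
      (fun k ↦ IsCyclotomicExtension.zeta (2 ^ k) ℚ (CyclotomicField (2 ^ k) ℚ))
      (fun k ↦ IsCyclotomicExtension.zeta_spec (2 ^ k) ℚ (CyclotomicField (2 ^ k) ℚ)) e F.τ hcoh heτ
  have h2 : (2 : ℚ_[2]) ≠ 0 := two_ne_zero
  -- (P2) Frobenius coordinates of the comparison functionals: `t₀(c′_i a) = 2^s ℓ_i(a)` on `𝒪`
  obtain ⟨s, c', hc'⟩ := ThetaTransport.ChildA.exists_frobeniusCoords π.t₀ π.ht₀ π.bO π.bO' π.hbO ℓ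
  have hc'' : ∀ (i : Fin n) (a : ↥(padicCoeffIntegers (Set.range ι))),
      ((π.t₀ (c' i * a) : ℤ_[2]) : ℚ_[2]) = (2 : ℚ_[2]) ^ s * ℓ i (a : PadicAlgCl 2) := by
    intro i a; rw [hc' i a, Nat.cast_ofNat]
  -- (P2) integrality exponents of the rational values: `2^{t_N} ι f_{N,k} = φ_{N,k} ∈ 𝒪`
  have hmem : ∀ (N : ℕ) (k : Fin (L N)), ι (f N k) ∈ padicCoeffField (Set.range ι) := fun N k ↦
    IntermediateField.subset_adjoin ℚ_[2] (Set.range ι) ⟨f N k, rfl⟩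
  have hφex : ∀ N : ℕ, ∃ (t : ℕ) (φ : Fin (L N) → ↥(padicCoeffIntegers (Set.range ι))),
      ∀ k, (φ k : PadicAlgCl 2) = algebraMap ℚ_[2] (PadicAlgCl 2) ((2 : ℚ_[2]) ^ t) * ι (f N k) := by
    intro N
    obtain ⟨t, ht⟩ := ThetaTransport.ChildA.exists_pow_forall_mul_mem_padicCoeffIntegers (Set.range ι)
      (fun k : Fin (L N) ↦ (⟨ι (f N k), hmem N k⟩ : padicCoeffField (Set.range ι)))
    refine ⟨t, fun k ↦ ⟨_, ht k⟩, fun k ↦ ?_⟩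
    simp only [Nat.cast_ofNat]
  choose t φ hφ using hφex
  -- the witnesses: `d_{N,j,k} = 2^{-(t_N+s)} t₀(φ_{N,k} bO′_j)`, `w_{N,j} = Σ_k d_{N,j,k} e_N(u_{N,k})`, `q = 2^{-s} ι(r)`, `μt = 1`
  obtain ⟨d, hd⟩ : ∃ d : ∀ N : ℕ, Fin π.nb → Fin (L N) → ℚ_[2],
      ∀ N j k, d N j k = ((2 : ℚ_[2]) ^ (t N + s))⁻¹ * ((π.t₀ (φ N k * π.bO' j) : ℤ_[2]) : ℚ_[2]) :=
    ⟨_, fun _ _ _ ↦ rfl⟩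
  obtain ⟨w, hw⟩ : ∃ w : ℕ → Fin π.nb → PadicAlgCl 2,
      ∀ N j, w N j = ∑ k : Fin (L N), algebraMap ℚ_[2] (PadicAlgCl 2) (d N j k) * e N (u N k) :=
    ⟨_, fun _ _ ↦ rfl⟩
  obtain ⟨q, hq⟩ : ∃ q : PadicAlgCl 2, q = algebraMap ℚ_[2] (PadicAlgCl 2) (((2 : ℚ_[2]) ^ s)⁻¹) * ι r := ⟨_, rfl⟩
  -- KEY: recombination along `bO` undoes the coordinates: `Σ_j bO_j Σ_k d_{N,j,k} A_k = 2^{-s} Σ_k ι(f_{N,k}) A_k`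
  have key : ∀ (N : ℕ) (Av : Fin (L N) → PadicAlgCl 2),
      ∑ j, (π.bO j : PadicAlgCl 2) * ∑ k, algebraMap ℚ_[2] (PadicAlgCl 2) (d N j k) * Av k =
        algebraMap ℚ_[2] (PadicAlgCl 2) (((2 : ℚ_[2]) ^ s)⁻¹) * ∑ k, ι (f N k) * Av k := by
    intro N Av
    have hswap : ∑ j, (π.bO j : PadicAlgCl 2) * ∑ k, algebraMap ℚ_[2] (PadicAlgCl 2) (d N j k) * Av k =
        ∑ k, (∑ j, algebraMap ℚ_[2] (PadicAlgCl 2) (d N j k) * (π.bO j : PadicAlgCl 2)) * Av k := by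
      simp only [Finset.mul_sum, Finset.sum_mul]
      rw [Finset.sum_comm]
      refine Finset.sum_congr rfl fun k _ ↦ Finset.sum_congr rfl fun j _ ↦ ?_
      ring
    rw [hswap, Finset.mul_sum]
    refine Finset.sum_congr rfl fun k _ ↦ ?_
    have h1 : ∑ j, algebraMap ℚ_[2] (PadicAlgCl 2) (d N j k) * (π.bO j : PadicAlgCl 2) =
        algebraMap ℚ_[2] (PadicAlgCl 2) (((2 : ℚ_[2]) ^ (t N + s))⁻¹) * (φ N k : PadicAlgCl 2) := by
      rw [ThetaTransport.ChildA.coe_eq_sum_t₀_mul_bO π.t₀ π.bO π.bO' π.hbO (φ N k), Finset.mul_sum]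
      refine Finset.sum_congr rfl fun j _ ↦ ?_
      rw [hd, map_mul, mul_assoc]
    have h2pow : ((2 : ℚ_[2]) ^ (t N + s))⁻¹ * (2 : ℚ_[2]) ^ t N = ((2 : ℚ_[2]) ^ s)⁻¹ := by
      rw [pow_add, mul_inv, mul_assoc, mul_comm ((2 : ℚ_[2]) ^ s)⁻¹, ← mul_assoc, inv_mul_cancel₀ (pow_ne_zero _ h2),
        one_mul]
    rw [h1, hφ N k, ← mul_assoc, ← map_mul, h2pow, mul_assoc]
  -- KEY-BK: `ℓ_i(a ι f_{N,k}) = Σ_j t₀(c′_i a bO_j) d_{N,j,k}`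
  have keyBK : ∀ (N : ℕ) (a : ↥(padicCoeffIntegers (Set.range ι))) (i : Fin n) (k : Fin (L N)),
      ℓ i ((a : PadicAlgCl 2) * ι (f N k)) = ∑ j, ((π.t₀ (c' i * a * π.bO j) : ℤ_[2]) : ℚ_[2]) * d N j k := by
    intro N a i k
    have hf : ι (f N k) = algebraMap ℚ_[2] (PadicAlgCl 2) (((2 : ℚ_[2]) ^ t N)⁻¹) * (φ N k : PadicAlgCl 2) := by
      rw [hφ N k, ← mul_assoc, ← map_mul, inv_mul_cancel₀ (pow_ne_zero _ h2), map_one, one_mul]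
    have h3 : (a : PadicAlgCl 2) * ι (f N k) =
        algebraMap ℚ_[2] (PadicAlgCl 2) (((2 : ℚ_[2]) ^ t N)⁻¹) * ((a * φ N k : ↥(padicCoeffIntegers (Set.range ι))) : PadicAlgCl 2) := by
      rw [hf]; push_cast; ring
    rw [h3, ← Algebra.smul_def, map_smul, smul_eq_mul]
    have h4 : ℓ i ((a * φ N k : ↥(padicCoeffIntegers (Set.range ι))) : PadicAlgCl 2) =
        ((2 : ℚ_[2]) ^ s)⁻¹ * ((π.t₀ (c' i * (a * φ N k)) : ℤ_[2]) : ℚ_[2]) := by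
      rw [hc'' i (a * φ N k), ← mul_assoc, inv_mul_cancel₀ (pow_ne_zero _ h2), one_mul]
    rw [h4, ← mul_assoc (c' i) a (φ N k), ThetaTransport.ChildA.coe_t₀_mul_eq_sum π.t₀ π.ht₀ π.bO π.bO' π.hbO (c' i * a) (φ N k),
      Finset.mul_sum, Finset.mul_sum]
    refine Finset.sum_congr rfl fun j _ ↦ ?_
    rw [hd, pow_add, mul_inv]
    ring
  -- the Galois sums of `w`: `τ_b • w_{N,j} = Σ_k d_{N,j,k} e_N(σ_b u_{N,k})`
  have hgal : ∀ (N : ℕ) (j : Fin π.nb) (b : (ZMod (2 ^ N))ˣ),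
      F.τ N (b : ZMod (2 ^ N)) • w N j = ∑ k, algebraMap ℚ_[2] (PadicAlgCl 2) (d N j k) * e N (sigma (2 ^ N) b (u N k)) := by
    intro N j b
    rw [hw, Finset.smul_sum]
    refine Finset.sum_congr rfl fun k _ ↦ ?_
    rw [ThetaTransport.ChildA.gal_smul_algebraMap_mul, ChildA.smul_frame_eq_map_sigma F.τ F.hτ e he]
  refine ⟨z, c', w, q, 1, ?_, one_ne_zero, ?_, ?_, ?_, ?_⟩
  · -- `q ≠ 0`
    rw [hq]
    refine mul_ne_zero ?_ ((map_ne_zero ι).mpr hr)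
    exact (map_ne_zero (algebraMap ℚ_[2] (PadicAlgCl 2))).mpr (inv_ne_zero (pow_ne_zero _ h2))
  · -- `CoordNondeg c′` from (ND)
    exact ThetaTransport.ChildA.injective_t₀Coords_of_injective π.t₀ ℓ hND s c' hc'
  · -- (BKρ) from (BK)
    intro a m i Q₀ hQv hker
    haveI := isIntegral_genFib_baseChange 2 ((WeierstrassCurve.integralModelInt W).map (Int.castRingHom ℤ_[2]))
    have hker' := (toLoc_symm_mem_kernel_iff (W := W)
      ((genFibΩ_eq_baseChange ((WeierstrassCurve.integralModelInt W).map (Int.castRingHom ℤ_[2]))).trans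
        (baseChange_twoAdicModel W)) Q₀).mp hker
    rw [hBK a m i Q₀ hQv hker', KatoBK.ptLogΩ_toLoc_symm_eq]
    simp only [hw]
    simp_rw [ThetaTransport.ChildA.sum_smul_mul_sum_algebraMap_mul, keyBK (m + 2) a i, map_sum, map_mul, Finset.sum_mul]
    rw [Finset.sum_comm]
    refine Finset.sum_congr rfl fun j _ ↦ ?_
    rw [Finset.mul_sum]
    refine Finset.sum_congr rfl fun k _ ↦ ?_
    ring
  · -- (VALρ) from (VAL) in the realisation `(ℚ̄₂, ι, e_N)`
    intro m ψ hψ1 hψ2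
    have hv := hVAL (m + 2) (by omega) (PadicAlgCl 2) ι (e (m + 2) : CyclotomicField (2 ^ (m + 2)) ℚ →+* PadicAlgCl 2)
      ψ hψ1 hψ2
    have htsum : (∑' k, algebraMap (PadicAlgCl 2) ℂ_[2]
        ((PowerSeries.coeff k (1 : IwasawaAlgebraO (Set.range ι)) : ↥(padicCoeffIntegers (Set.range ι))) : PadicAlgCl 2) *
          (algebraMap (PadicAlgCl 2) ℂ_[2] (ψ (5 : ZMod (2 ^ (m + 2)))) - 1) ^ k) = 1 := by
      rw [tsum_eq_single 0]
      · simp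
      · intro k hk
        simp [PowerSeries.coeff_one, hk]
    have hX : ∑ j, (π.bO j : PadicAlgCl 2) *
        ∑ b : (ZMod (2 ^ (m + 2)))ˣ, ψ⁻¹ (b : ZMod (2 ^ (m + 2))) * F.τ (m + 2) (b : ZMod (2 ^ (m + 2))) • w (m + 2) j =
        algebraMap ℚ_[2] (PadicAlgCl 2) (((2 : ℚ_[2]) ^ s)⁻¹) *
          ∑ k, ι (f (m + 2) k) * ∑ b : (ZMod (2 ^ (m + 2)))ˣ, ψ⁻¹ (b : ZMod (2 ^ (m + 2))) * e (m + 2) (sigma (2 ^ (m + 2)) b (u (m + 2) k)) := by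
      have hj : ∀ j, ∑ b : (ZMod (2 ^ (m + 2)))ˣ, ψ⁻¹ (b : ZMod (2 ^ (m + 2))) * F.τ (m + 2) (b : ZMod (2 ^ (m + 2))) • w (m + 2) j =
          ∑ k, algebraMap ℚ_[2] (PadicAlgCl 2) (d (m + 2) j k) *
            ∑ b : (ZMod (2 ^ (m + 2)))ˣ, ψ⁻¹ (b : ZMod (2 ^ (m + 2))) * e (m + 2) (sigma (2 ^ (m + 2)) b (u (m + 2) k)) := by
        intro j
        simp_rw [hgal, Finset.mul_sum]
        rw [Finset.sum_comm]
        refine Finset.sum_congr rfl fun k _ ↦ Finset.sum_congr rfl fun b _ ↦ ?_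
        ring
      simp_rw [hj]
      exact key (m + 2) _
    have hgauss : gaussSum ψ (AddChar.zmodChar (2 ^ (m + 2)) (HondaLog.zeta_pow_prime_pow_self (p := 2) (m + 2))) =
        gaussSum ψ (AddChar.zmodChar (2 ^ (m + 2))
          (((IsCyclotomicExtension.zeta_spec (2 ^ (m + 2)) ℚ (CyclotomicField (2 ^ (m + 2)) ℚ)).map_of_injective
            (e (m + 2) : CyclotomicField (2 ^ (m + 2)) ℚ →+* PadicAlgCl 2).injective).pow_eq_one)) := by
      congr 1
      exact ChildA.zmodChar_eq_of_eq _ _ (by rw [← he (m + 2)]; rfl)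
    have hv' : (∑ k, ι (f (m + 2) k) *
          ∑ b : (ZMod (2 ^ (m + 2)))ˣ, ψ⁻¹ (b : ZMod (2 ^ (m + 2))) * e (m + 2) (sigma (2 ^ (m + 2)) b (u (m + 2) k))) *
        gaussSum ψ (AddChar.zmodChar (2 ^ (m + 2)) (HondaLog.zeta_pow_prime_pow_self (p := 2) (m + 2))) =
        ι r * ∑ a : ZMod (2 ^ (m + 2)), ψ a * ι (plusSymbolK g Ω ((a.val : ℚ) / (2 : ℚ) ^ (m + 2))) := by
      rw [hgauss]; exact hv
    rw [hX, mul_assoc, hv', htsum, mul_one, ← map_mul, hq, mul_assoc]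
  · -- (TRIVρ) from (TRIV) at `N = 2, 3` with `a₂(g) = 0`, `M` odd
    intro k hk2 hk3
    have ht := hTRIV k hk2 (PadicAlgCl 2) ι (e k : CyclotomicField (2 ^ k) ℚ →+* PadicAlgCl 2)
    have ha2' : (⟨cuspCoeff g 2, coeff_mem_coeffField g 2⟩ : coeffField g) = 0 := Subtype.ext ha2
    have hodd : ¬ 2 ∣ M := hM.not_two_dvd_nat
    rw [ha2', map_zero, if_neg hodd] at ht
    have hX : ∑ j, (π.bO j : PadicAlgCl 2) * ∑ b : (ZMod (2 ^ k))ˣ, F.τ k (b : ZMod (2 ^ k)) • w k j =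
        algebraMap ℚ_[2] (PadicAlgCl 2) (((2 : ℚ_[2]) ^ s)⁻¹) *
          ∑ k', ι (f k k') * ∑ b : (ZMod (2 ^ k))ˣ, e k (sigma (2 ^ k) b (u k k')) := by
      have hj : ∀ j, ∑ b : (ZMod (2 ^ k))ˣ, F.τ k (b : ZMod (2 ^ k)) • w k j =
          ∑ k', algebraMap ℚ_[2] (PadicAlgCl 2) (d k j k') * ∑ b : (ZMod (2 ^ k))ˣ, e k (sigma (2 ^ k) b (u k k')) := by
        intro j
        simp_rw [hgal, Finset.mul_sum]
        rw [Finset.sum_comm]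
      simp_rw [hj]
      exact key k _
    have hS : ∑ k', ι (f k k') * ∑ b : (ZMod (2 ^ k))ˣ, e k (sigma (2 ^ k) b (u k k')) =
        (3 / 2 : PadicAlgCl 2) * (ι r * ι (plusSymbolK g Ω 0)) := by
      have h2A : (2 : PadicAlgCl 2) ≠ 0 := two_ne_zero
      apply mul_left_cancel₀ h2A
      have ht' : 2 * ∑ k', ι (f k k') * ∑ b : (ZMod (2 ^ k))ˣ, e k (sigma (2 ^ k) b (u k k')) =
          ι r * (2 - 0 + 1) * ι (plusSymbolK g Ω 0) := ht
      rw [ht']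
      field_simp
      ring
    rw [hX, hS, hq]
    simp only [PowerSeries.coeff_zero_eq_constantCoeff, map_one, OneMemClass.coe_one, mul_one]
    ring

end Port

/-! ## §3 The registered stub `stub_kzgChildA` of line `onepair` from the named fact -/

set_option maxHeartbeats 1600000 in
/-- **Child A `stub_kzgChildA` of line `onepair` (crux RSL_g, stmt-BirchSwinnertonDyer-22608) — the REGISTERED v3g TEXT, from Kato 2004
Thm. 12.5 (1) BY NAME.** Under the one print hypothesis `Kato2004.exists_zetaElement_newform_tatePairing_values_two` (typed, p726418), for every
datum of RSL_g, every pin bundle `π` and every `2`-adic frame `F`, a valued class exists at the pins: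
`∃ z c′ w q μt, π.KatoValuedClass g ι Ω F.Φ F.τ z c′ w q μt` — by `katoValuedClass_of_zetaElement` (the idle binders of the registered text are
not used). Splice for the LEAD: with the fact joined to `stub_printInputs`, `stub_kzgChildA := stub_kzgChildA_of_zetaElement ‹fact›`.
[cite: Kato2004Asterisque, Thm. 12.5 (1) (pp. 221–222), Thm. 12.6, §15.16 (p. 265)] [cite: BlochKato1990, §3 (3.10.1), (3.11) (pp. 359–361)] -/
theorem stub_kzgChildA_of_zetaElement
    (hfact : Literature.NumberTheory.EllipticCurves.Kato2004.exists_zetaElement_newform_tatePairing_values_two) :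
    open Literature.NumberTheory.EllipticCurves GreenbergSelmer GreenbergVatsal2000 Kobayashi2003 ModularForms Rank1Residual Literature.NumberTheory.GaloisRepresentations Literature.NumberTheory.Automorphic IsDedekindDomain NumberField Field Rat.HeightOneSpectrum PowerSeries Summit.BirchSwinnertonDyer.BirchSwinnertonDyer.Theorems.OnePair in ∀ (W : WeierstrassCurve ℚ) [W.IsElliptic] [W.IsGloballyMinimal], ¬ W.HasCM → W.analyticRank = 0 → GoodSS W 2 → W.frobeniusTrace 2 = 0 → W.Δ < 0 → ∀ (M : ℕ) [NeZero M] (g : CuspForm (CongruenceSubgroup.Gamma0 M) 2) (ι : coeffField g →+* PadicAlgCl 2) (Ω : ℂ), Odd M → IsNewform0 g → IsCMForm (liftToGamma1 M 2 g) → cuspCoeff g 2 = 0 → IsCohomologicalPlusPeriod g ι Ω → (∀ ℓ : ℕ, ℓ.Prime → ¬ ℓ ∣ 2 * M * W.conductorNorm ℤ → ‖embCoeff g ι ℓ - (W.frobeniusTrace ℓ : PadicAlgCl 2)‖ < 1) → ∀ (κ : ZpExtension ℚ 2) (γ : absoluteGaloisGroup ℚ), κ.IsCyclotomic → κ.IsTopGenerator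 γ → IsCyclotomicVariable 2 γ → ∀ (S₀ : Finset (HeightOneSpectrum (RingOfIntegers ℚ))), (∀ v ∈ S₀, ((2 : ℕ) : RingOfIntegers ℚ) ∉ v.asIdeal) → (∀ v, ¬ W.HasGoodReductionAt v → v ∈ S₀) → (∀ v, natGenerator v ∣ M → v ∈ S₀) → ∀ (Lp Lm : IwasawaAlgebraO (Set.range ι)) (d : ℕ), IsPollackPairK g ι Ω Lp Lm → (∀ k, ‖coeff k (iwasawaOToPowerSeries (Set.range ι) Lm)‖ ≤ ‖coeff d (iwasawaOToPowerSeries (Set.range ι) Lm)‖) → (∀ k < d, ‖coeff k (iwasawaOToPowerSeries (Set.range ι) Lm)‖ < ‖coeff d (iwasawaOToPowerSeries (Set.range ι) Lm)‖) → ∀ (n : ℕ) (ρ : FramedGaloisRep ℚ (coeffO (Set.range ι)) 2) (Θ : ∀ v : HeightOneSpectrum (RingOfIntegers ℚ), ((2 : ℕ) : RingOfIntegers ℚ) ∈ v.asIdeal → (CofreeF (Set.range ι) ρ ≃+ (Fin n → ↥(W.geomPrimaryTorsion 2)))), (∀ v, ¬ natGenerator v ∣ 2 * M → ρ.IsUnramifiedAt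 v ∧ ∃ P : Polynomial (coeffO (Set.range ι)), P.map (padicCoeffIntegers (Set.range ι)).subtype = Polynomial.X ^ 2 - Polynomial.C (embCoeff g ι (natGenerator v)) * Polynomial.X + Polynomial.C ((natGenerator v : ℕ) : PadicAlgCl 2) ∧ ρ.HasFrobCharpolyAt v P) → ∀ (hΘ : ∀ v hv (δ : absoluteGaloisGroup (v.adicCompletion ℚ)) m i, Θ v hv (resGalOfEmb (closureEmb (K := ℚ) (v.adicCompletion ℚ)) δ • m) i = resGalOfEmb (closureEmb (K := ℚ) (v.adicCompletion ℚ)) δ • Θ v hv m i), ∀ (ϖ : (coeffO (Set.range ι))), Irreducible ϖ → ∀ (Sg : AddSubgroup (H1Γ (Set.range ι) κ ρ)) [Module (coeffO (Set.range ι)) ↥Sg], (∀ (a : (coeffO (Set.range ι))) (s : ↥Sg), ((a • s : ↥Sg) : H1Γ (Set.range ι) κ ρ) = scalarH1 κ.kerSubgroup (CofreeF (Set.range ι) ρ) a s) → (∀ y : H1Γ (Set.range ι) κ ρ, y ∈ Sg ↔ y ∈ plusSelmerSet (Set.range ι) W κ S₀ n ρ Θ) → (∀ (τ : absoluteGaloisGroup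 ℚ) (y : H1Γ (Set.range ι) κ ρ), y ∈ Sg → conjH1 κ.kerSubgroup (CofreeF (Set.range ι) ρ) τ y ∈ Sg) → (plusSelmerTorsionSet (Set.range ι) W κ S₀ n ρ Θ ϖ).Finite → ∀ (I : Kato2004.IwasawaH1DataCoeff (FramedGaloisRep.toGaloisRep ρ) 2 κ γ) [Module (coeffO (Set.range ι)) I.H] [IsScalarTower (coeffO (Set.range ι)) (IwasawaAlgebraO (Set.range ι)) I.H], (∀ (a : (coeffO (Set.range ι))) (x : I.H), a • x = (PowerSeries.C a : IwasawaAlgebraO (Set.range ι)) • x) → ∀ (π : OnePairPins (Set.range ι) W κ γ S₀ n ρ Θ hΘ I Sg), ∀ (F : π.KatoFrame), ∃ (z : I.H) (c' : Fin n → coeffO (Set.range ι)) (w : ℕ → Fin π.nb → PadicAlgCl 2) (q : PadicAlgCl 2) (μt : IwasawaAlgebraO (Set.range ι)), π.KatoValuedClass g ι Ω F.Φ F.τ z c' w q μt := by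
  intro W _ _ hcm hr hss ha hΔ M _ g ι Ω hM hg hcmg ha2 hΩ hcong κ γ hκ hγ hcv S₀ hS₀2 hS₀bad hS₀M Lp Lm d hPP hlam1 hlam2 n ρ Θ hfrob hΘ ϖ hϖ
    Sg _ hSg1 hSg2 hSg3 hfin I _ _ hIC π F
  exact katoValuedClass_of_zetaElement g ι Ω π F hfact hg hΩ.isPlusPeriod hM ha2 hfrob hκ hγ

end Summit.BirchSwinnertonDyer.BirchSwinnertonDyer.Theorems.OnePair

end
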